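import Mathlib.Data.ZMod.Basic
import Mathlib.GroupTheory.OrderOfElement
import Mathlib.Analysis.SpecialFunctions.Pow.Real
import Mathlib.Order.Filter.AtTopBot.Basic
import Mathlib.Algebra.Polynomial.Eval.Defs
import Literature.Computability.Complexity.ConstantDepth
import HarnessLib
import HarnessLib.Audit

/-!
# The decisional Diffie–Hellman assumption (non-uniform, subexponential form) and the
Naor–Reingold pseudo-random functions

Trunk `CryptoQuantFine`, topic `Computability/Cryptography`. Vendored from
M. Naor, O. Reingold, *Number-theoretic constructions of efficient pseudo-random functions*,
J. ACM 51 (2004) 231–262 (held: `lit read paper:doi-10-1145-972639-972643`), for the barrier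
entry `Literature.Barriers.PneNP.NaturalProofsTC0` (no natural proofs against `TC⁰` if `TC⁰`
contains hard pseudo-random functions): that file records the crypto input only as the
unformalised hypothesis `Literature.Barriers.PneNP.HardPRFInTC0`; here we formalise the
number-theoretic ASSUMPTION from which Naor–Reingold derive it and the explicit construction.

## Contents (source items → declarations)

* §3.2 (p. 242: instances `⟨P, Q, g⟩`, `P` an `n`-bit prime, `Q` a prime divisor of `P - 1`,
  `g` of order `Q` in `ℤ_P^*`; "it is not inconceivable that the assumption holds when for every
  `n` we have a single possible choice of `P, Q` and `g`") → `IsDDHInstance m P Q g`.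
* Assumption 3.1 (p. 243, decisional Diffie–Hellman: no efficient `A` tells
  `⟨g^a, g^b, g^{ab}⟩` from `⟨g^a, g^b, g^c⟩`, `a, b, c` uniform in `ℤ_Q`) →
  `ddhRealAccept`, `ddhRandAccept`, `ddhAdvantage` (exact counts over `ℤ_Q², ℤ_Q³`, in the
  style of `Literature.Computability.MetaComplexity.prgAdvantage`), and the NON-UNIFORM SUBEXPONENTIAL form
  `DDHSubexpHard P Q g` / `SubexpDDH` ("the assumption holds against a subexponential-time
  adversary", p. 237; made precise as in Razborov–Rudich / Arora–Barak §23.3: `B₂`-circuits of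
  size `≤ 2^{m^δ}` have advantage `< 2^{-m^δ}` for all large `m`, some fixed `δ > 0`).
* Construction 4.1 (p. 245: `f_{P,Q,g,ā}(x) = (g^{a₀})^{∏_{xᵢ=1} aᵢ}`) → `nrFun` (a real `def`),
  with `nrFun_apply_false` (`f(0ⁿ) = g^{a₀}`) and `nrFun_update_true` (setting the bit `xᵢ`
  raises the value to the power `aᵢ` — the "linear" structure behind Thm. 4.1's hybrid proof).
* Theorem 4.5 (p. 252: after preprocessing, every `f_k ∈ Fₙ` is computed by a depth-`d`
  threshold circuit of size `p(n)`) → named fact `NaorReingold2004_thm45` (per output bit, over the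
  tree's threshold basis `tcBasis` with depth `Circuit.acDepth`; not proved here: it rests on
  iterated multiplication in `TC⁰`, Beame–Cook–Hoover / Reif–Tate / Siu et al., p. 251).

Theorem 4.1 (DDH ⟹ pseudo-randomness, a hybrid argument over oracle machines) and the
natural-proofs consequence of p. 237 are NOT restated here; the latter is vendored, in the
tree's natural-proofs vocabulary, in `Literature/Barriers/PneNP/NaturalProofsTC0DDH.lean`.

## Design choices

* Adversaries are `B₂`-circuits (`Circuit (Fin 3 × Fin m)`, `IsOver B2`, `size`), reading the
  `3m` bits of `⟨g^a, g^b, g^c⟩` (little-endian binary of the canonical representatives in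
  `[0, P)`, `P < 2^m`); `P, Q, g` are fixed per security parameter and need not be inputs
  (they can be hard-wired). Naor–Reingold's Assumption 3.1 is for uniform probabilistic
  polynomial-time `A` and an instance generator `IG`; the natural-proofs application (p. 237,
  via Razborov–Rudich 1997, §4, whose hardness `H` is against circuits) needs security against
  non-uniform subexponential-size adversaries, which is the form defined here. A deterministic
  `IG` (one instance per `n`) is explicitly allowed by the source (p. 242), so an instance
  SEQUENCE `P Q g : ℕ → ℕ` stands for `IG`; `SubexpDDH` asserts hardness for SOME sequence.
* Probabilities are exact ratios of counts over `Fin Q × Fin Q` (real triples, `c = ab`) and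
  `Fin Q × Fin Q × Fin Q` (random triples), as in `prgAdvantage`; for `Q = 0` both counts are `0`
  (junk, excluded by `IsDDHInstance`).
* "`P` is an `m`-bit prime" is `2^(m-1) ≤ P < 2^m` (fields `two_pow_le : 2 ^ m ≤ 2 * P`,
  `lt_two_pow : P < 2 ^ m`); "`g` of order `Q` in `ℤ_P^*`" is
  `orderOf (g : ZMod P) = Q` (so `g ≢ 0`), with `g < P` a canonical representative.
* `nrFun P g a x : ZMod P` takes the key exponents `a : Fin (n+1) → ℕ` as natural numbers
  (elements of `ℤ_Q` via their representatives; Thm. 4.5's hypothesis `aᵢ < Q` is stated where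
  used) and is meaningful for every modulus `P`.
* Mathlib has none of DDH / Diffie–Hellman / pseudo-random functions in `TC⁰` (searched `Diffie`,
  `DDH`, `ElGamal`: nothing); reused: `ZMod`, `orderOf`, `Nat.testBit`, `Real.rpow`,
  `Filter.atTop`, `Polynomial.eval`, and the tree's `Circuit`, `B2`, `tcBasis`, `Circuit.acDepth`.

## References

* [NaorReingold2004] M. Naor, O. Reingold, J. ACM 51 (2004) 231–262: §3.2 (p. 242),
  Assumption 3.1 (p. 243), Construction 4.1 and Thm. 4.1 (pp. 245–246), §4.2 and Thm. 4.5
  (pp. 251–252), p. 237 (natural proofs remark).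
* [RazborovRudich1997] A. Razborov, S. Rudich, *Natural proofs*, JCSS 55 (1997), §4 (hardness
  against circuits, `2^{n^ε}`-hardness).
* [AroraBarakCC2009] S. Arora, B. Barak, *Computational Complexity* (2009), §23.3 (PDF p. 591:
  security against `2^{m^ε}`-time adversaries in the natural-proofs argument).
-/

noncomputable section

namespace Literature.Computability.Cryptography

open Complexity Finset Filter

/-! ### DDH instances and the advantage of a circuit -/

/-- **A DDH instance at security parameter `m`** (Naor–Reingold's `⟨P, Q, g⟩ ← IG(1ᵐ)`): `P` is
an `m`-bit prime (`2^{m-1} ≤ P < 2^m`, the lower bound written `2^m ≤ 2P`), `Q` is a prime divisor of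
`P - 1`, and `g < P` represents an element of order `Q` in `ℤ_P^*`. [cite: NaorReingold2004, §3.2 (p. 242)] -/
structure IsDDHInstance (m P Q g : ℕ) : Prop where
  /-- `P` is prime. -/
  prime_P : P.Prime
  /-- `Q` is prime. -/
  prime_Q : Q.Prime
  /-- `Q` divides `P - 1`. -/
  dvd : Q ∣ P - 1
  /-- `P` has at least `m` bits (`2^{m-1} ≤ P`, written without `ℕ`-subtraction) … -/
  two_pow_le : 2 ^ m ≤ 2 * P
  /-- … and at most `m` bits. -/
  lt_two_pow : P < 2 ^ m
  /-- `g` is a canonical representative. -/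
  g_lt : g < P
  /-- `g` has order exactly `Q` in `ℤ_P^*`. -/
  orderOf_eq : orderOf (g : ZMod P) = Q

/-- The `3m` input bits handed to a DDH adversary: the little-endian binary expansions
(`Nat.testBit`, `m` bits each) of the canonical representatives of a triple
`t = (t₀, t₁, t₂)` of residues modulo `P` — in the assumption, `⟨g^a, g^b, g^{ab}⟩` or
`⟨g^a, g^b, g^c⟩`. [cite: NaorReingold2004, Assumption 3.1 (p. 243)] -/
def ddhEncode (m P : ℕ) (t : Fin 3 → ZMod P) : Fin 3 × Fin m → Bool :=
  fun ji => (t ji.1).val.testBit ji.2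

/-- Number of Diffie–Hellman triples accepted: `#{(a, b) ∈ ℤ_Q² | C(g^a, g^b, g^{ab}) = 1}`.
[cite: NaorReingold2004, Assumption 3.1 (p. 243)] -/
def ddhRealAccept (m P Q g : ℕ) (C : Circuit (Fin 3 × Fin m)) : ℕ :=
  #{ab : Fin Q × Fin Q | C.eval (ddhEncode m P
      ![(g : ZMod P) ^ (ab.1 : ℕ), (g : ZMod P) ^ (ab.2 : ℕ),
        (g : ZMod P) ^ ((ab.1 : ℕ) * (ab.2 : ℕ))]) = true}

/-- Number of random triples accepted: `#{(a, b, c) ∈ ℤ_Q³ | C(g^a, g^b, g^c) = 1}`.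
[cite: NaorReingold2004, Assumption 3.1 (p. 243)] -/
def ddhRandAccept (m P Q g : ℕ) (C : Circuit (Fin 3 × Fin m)) : ℕ :=
  #{abc : Fin Q × Fin Q × Fin Q | C.eval (ddhEncode m P
      ![(g : ZMod P) ^ (abc.1 : ℕ), (g : ZMod P) ^ (abc.2.1 : ℕ),
        (g : ZMod P) ^ (abc.2.2 : ℕ)]) = true}

/-- **The DDH advantage of a circuit** `C` against the instance `⟨P, Q, g⟩`:
`|Pr_{a,b ∈ ℤ_Q}[C(g^a, g^b, g^{ab}) = 1] - Pr_{a,b,c ∈ ℤ_Q}[C(g^a, g^b, g^c) = 1]|`, with exact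
counts (`ddhRealAccept / Q²`, `ddhRandAccept / Q³`). [cite: NaorReingold2004, Assumption 3.1 (p. 243)] -/
def ddhAdvantage (m P Q g : ℕ) (C : Circuit (Fin 3 × Fin m)) : ℝ :=
  |(ddhRealAccept m P Q g C : ℝ) / (Q : ℝ) ^ 2 - (ddhRandAccept m P Q g C : ℝ) / (Q : ℝ) ^ 3|

/-- **The DDH assumption against subexponential non-uniform adversaries, for the instance
sequence `(P_m, Q_m, g_m)`**: for some fixed `δ > 0` and all sufficiently large `m`,
`⟨P_m, Q_m, g_m⟩` is a DDH instance at security parameter `m` and every `B₂`-circuit of size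
`≤ 2^{m^δ}` reading `⟨g^a, g^b, z⟩` has DDH advantage `< 2^{-m^δ}`. This is Assumption 3.1 with
"probabilistic polynomial time, advantage `< 1/m^α`" replaced by the `2^{m^δ}`-hardness against
circuits that the natural-proofs application consumes ("holds against a subexponential-time
adversary"). [cite: NaorReingold2004, Assumption 3.1 (p. 243) and p. 237] [cite: RazborovRudich1997, §4] [cite: AroraBarakCC2009, §23.3 (PDF p. 591)] -/
def DDHSubexpHard (P Q g : ℕ → ℕ) : Prop :=
  ∃ δ : ℝ, 0 < δ ∧ ∀ᶠ m : ℕ in atTop, IsDDHInstance m (P m) (Q m) (g m) ∧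
    ∀ C : Circuit (Fin 3 × Fin m), C.IsOver B2 → (C.size : ℝ) ≤ (2 : ℝ) ^ ((m : ℝ) ^ δ) →
      ddhAdvantage m (P m) (Q m) (g m) C < (2 : ℝ) ^ (-((m : ℝ) ^ δ))

/-- **Subexponential DDH**: for SOME instance sequence — i.e. some (deterministic, non-uniform)
instance generator `IG` — the decisional Diffie–Hellman assumption holds against
subexponential-size circuits. Any instantiation of `IG` gives "a different DDH-Assumption"
(p. 242); this is the weakest such. It is STRONGER than the hypothesis of Naor–Reingold's
natural-proofs remark (p. 237), which is the GDH assumption (§5.1; implied by DDH, Cor. 5.1, and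
by the hardness of factoring Blum integers, §5.4) against subexponential-time adversaries: DDH
instead of GDH, circuits instead of uniform machines — so p. 237 does not state consequences of
`SubexpDDH` verbatim; they follow from it. An open hypothesis, used only on the left of
implications. [cite: NaorReingold2004, §3.2 (p. 242), Assumption 3.1 (p. 243), Cor. 5.1 (p. 253), p. 237] -/
@[conjecture] def SubexpDDH : Prop := ∃ P Q g : ℕ → ℕ, DDHSubexpHard P Q g

/-! ### Construction 4.1: the Naor–Reingold functions -/

/-- **Naor–Reingold's Construction 4.1**: for a modulus `P`, a base `g` and key exponents
`ā = (a₀, a₁, …, aₙ)`, the function `f_{P,Q,g,ā} : {0,1}ⁿ → ⟨g⟩ ⊆ ℤ_P`,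
`f(x) = (g^{a₀})^{∏_{i : xᵢ = 1} aᵢ} = g^{a₀ · ∏_{xᵢ = 1} aᵢ}`. (The prime `Q = ord g` enters only
through the key distribution, `aᵢ` uniform in `ℤ_Q`.) [cite: NaorReingold2004, Construction 4.1 (p. 245)] -/
def nrFun (P g : ℕ) {n : ℕ} (a : Fin (n + 1) → ℕ) (x : Fin n → Bool) : ZMod P :=
  (g : ZMod P) ^ (a 0 * ∏ i : Fin n, if x i then a i.succ else 1)

/-- At the all-zero input the Naor–Reingold function takes the value `g^{a₀}` (empty subset
product). [cite: NaorReingold2004, Construction 4.1 (p. 245)] -/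
@[simp] theorem nrFun_apply_false (P g : ℕ) {n : ℕ} (a : Fin (n + 1) → ℕ) :
    nrFun P g a (fun _ => false) = (g : ZMod P) ^ a 0 := by
  simp [nrFun]

/-- The exponent's subset product, with the bit `i` switched on, gains the factor `a_{i+1}`.
[cite: NaorReingold2004, Construction 4.1 (p. 245)] -/
theorem prod_update_true {n : ℕ} (a : Fin (n + 1) → ℕ) (x : Fin n → Bool) (i : Fin n)
    (hi : x i = false) :
    (∏ j : Fin n, if Function.update x i true j then a j.succ else 1) =
      a i.succ * ∏ j : Fin n, if x j then a j.succ else 1 := by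
  have h1 : (fun j : Fin n => if Function.update x i true j then a j.succ else 1) =
      Function.update (fun j : Fin n => if x j then a j.succ else 1) i (a i.succ) := by
    funext j
    by_cases hj : j = i
    · subst hj; simp
    · simp [Function.update_of_ne hj]
  rw [h1, Finset.prod_update_of_mem (Finset.mem_univ i)]
  congr 1
  refine Finset.prod_subset (Finset.subset_univ _) fun j _ hj => ?_
  have hji : j = i := by simpa using hj
  subst hji
  simp [hi]

/-- **The multiplicative ("linear") structure of Construction 4.1**: switching the input bit `xᵢ`
from `0` to `1` raises the value to the power `a_{i+1}`:
`f(x[i ↦ 1]) = f(x)^{a_{i+1}}` — the relation `f(x1) = f(x0)^{a}` driving the hybrid argument of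
Thm. 4.1 (cf. the GGM analogy `G_1(s)` vs `G_0(s)`, p. 247). [cite: NaorReingold2004, Construction 4.1 (p. 245) and §4.1 (p. 247)] -/
theorem nrFun_update_true (P g : ℕ) {n : ℕ} (a : Fin (n + 1) → ℕ) (x : Fin n → Bool)
    (i : Fin n) (hi : x i = false) :
    nrFun P g a (Function.update x i true) = nrFun P g a x ^ a i.succ := by
  unfold nrFun
  rw [prod_update_true a x i hi, ← pow_mul]
  congr 1
  ring

/-! ### Theorem 4.5: evaluation in `TC⁰` (named fact) -/

/-- **Naor–Reingold 2004, Theorem 4.5 (the functions of Construction 4.1 are in `TC⁰`)**: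
"there exists a polynomial `p(·)` and an integer `d` such that, for every `n ∈ ℕ` and every
function `f_k ∈ Fₙ`, there exists a depth `d` threshold circuit of size bounded by `p(n)` that
computes `f_k`" — after preprocessing of the key (the values `g^{2^i}`), evaluation is two
multiple products and these are in `TC⁰` (Beame–Cook–Hoover; Reif–Tate; Siu et al.). Stated per
output bit (the `j`-th bit of the canonical representative of `f_k(x) ∈ ℤ_P`, `j < n` since
`P < 2ⁿ`) for single-output circuits over the tree's threshold basis `tcBasis` (`∧, ∨, ¬, MAJ` of
unbounded fan-in; threshold gates are majority gates with constant inputs) with depth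
`Circuit.acDepth` (negations free); keys as in Construction 4.1: `⟨P, Q, g⟩` an instance at
security parameter `n` = input length, `aᵢ ∈ ℤ_Q`. A named fact (`Prop`), not proved here: the
`TC⁰` circuits for iterated multiplication are not in the tree. [cite: NaorReingold2004, Thm. 4.5 (p. 252) and §4.2 (p. 251)] -/
def NaorReingold2004_thm45 : Prop :=
  ∃ (d : ℕ) (p : Polynomial ℕ), ∀ (n P Q g : ℕ) (a : Fin (n + 1) → ℕ),
    IsDDHInstance n P Q g → (∀ i, a i < Q) → ∀ j : Fin n,
      ∃ C : Circuit (Fin n), C.IsOver tcBasis ∧ C.acDepth ≤ d ∧ C.size ≤ p.eval n ∧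
        C.Computes fun x => (nrFun P g a x).val.testBit j

/-! ### API -/

/-- The DDH advantage is nonnegative (an absolute value). [cite: NaorReingold2004, Assumption 3.1 (p. 243)] -/
theorem ddhAdvantage_nonneg (m P Q g : ℕ) (C : Circuit (Fin 3 × Fin m)) :
    0 ≤ ddhAdvantage m P Q g C :=
  abs_nonneg _

/-- At most `Q²` Diffie–Hellman pairs are accepted. [cite: NaorReingold2004, Assumption 3.1 (p. 243)] -/
theorem ddhRealAccept_le (m P Q g : ℕ) (C : Circuit (Fin 3 × Fin m)) :
    ddhRealAccept m P Q g C ≤ Q ^ 2 := by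
  unfold ddhRealAccept
  refine (Finset.card_filter_le _ _).trans ?_
  simp [sq]

/-- At most `Q³` random triples are accepted. [cite: NaorReingold2004, Assumption 3.1 (p. 243)] -/
theorem ddhRandAccept_le (m P Q g : ℕ) (C : Circuit (Fin 3 × Fin m)) :
    ddhRandAccept m P Q g C ≤ Q ^ 3 := by
  unfold ddhRandAccept
  refine (Finset.card_filter_le _ _).trans ?_
  simp [pow_succ, mul_assoc]

/-- The DDH advantage is at most `1` (a difference of two probabilities).
[cite: NaorReingold2004, Assumption 3.1 (p. 243)] -/
theorem ddhAdvantage_le_one (m P Q g : ℕ) (C : Circuit (Fin 3 × Fin m)) :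
    ddhAdvantage m P Q g C ≤ 1 := by
  unfold ddhAdvantage
  have hR : (ddhRealAccept m P Q g C : ℝ) / (Q : ℝ) ^ 2 ≤ 1 := by
    rcases Nat.eq_zero_or_pos Q with hQ | hQ
    · subst hQ; simp
    · rw [div_le_one (by positivity)]
      exact_mod_cast ddhRealAccept_le m P Q g C
  have hR' : (ddhRandAccept m P Q g C : ℝ) / (Q : ℝ) ^ 3 ≤ 1 := by
    rcases Nat.eq_zero_or_pos Q with hQ | hQ
    · subst hQ; simp
    · rw [div_le_one (by positivity)]
      exact_mod_cast ddhRandAccept_le m P Q g C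
  have h0 : (0 : ℝ) ≤ (ddhRealAccept m P Q g C : ℝ) / (Q : ℝ) ^ 2 := by positivity
  have h0' : (0 : ℝ) ≤ (ddhRandAccept m P Q g C : ℝ) / (Q : ℝ) ^ 3 := by positivity
  rw [abs_sub_le_iff]
  constructor <;> linarith

/-- `SubexpDDH` unfolds to the existence of a hard instance sequence (by definition).
[cite: NaorReingold2004, §3.2 (p. 242)] -/
theorem subexpDDH_iff : SubexpDDH ↔ ∃ P Q g : ℕ → ℕ, DDHSubexpHard P Q g := Iff.rfl

/-- A hard instance sequence consists of genuine DDH instances from some point on.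
[cite: NaorReingold2004, §3.2 (p. 242)] -/
theorem DDHSubexpHard.eventually_isDDHInstance {P Q g : ℕ → ℕ} (h : DDHSubexpHard P Q g) :
    ∀ᶠ m : ℕ in atTop, IsDDHInstance m (P m) (Q m) (g m) := by
  obtain ⟨δ, -, hδ⟩ := h
  exact hδ.mono fun m hm => hm.1

/-- In a DDH instance the base `g` is nonzero in `ZMod P` (it has prime order `Q`, whereas
`orderOf 0 = 0`). [cite: NaorReingold2004, §3.2 (p. 242)] -/
theorem IsDDHInstance.cast_ne_zero {m P Q g : ℕ} (h : IsDDHInstance m P Q g) :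
    (g : ZMod P) ≠ 0 := by
  intro hg
  have hP : Fact (1 < P) := ⟨h.prime_P.one_lt⟩
  have h0 : orderOf (g : ZMod P) = 0 := by
    rw [hg]
    exact orderOf_eq_zero_iff'.2 fun n hn h1 => by
      rw [zero_pow (Nat.pos_iff_ne_zero.1 hn)] at h1
      exact zero_ne_one h1
  exact h.prime_Q.ne_zero (h.orderOf_eq ▸ h0)

/-- In a DDH instance, `g^Q = 1` in `ℤ_P`. [cite: NaorReingold2004, §3.2 (p. 242)] -/
theorem IsDDHInstance.pow_eq_one {m P Q g : ℕ} (h : IsDDHInstance m P Q g) :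
    (g : ZMod P) ^ Q = 1 := by
  rw [← h.orderOf_eq]
  exact pow_orderOf_eq_one _

end Literature.Computability.Cryptography

end
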